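import Literature.Probability.LatticeModels.CoarseCellMixingDefectsCubeStep
import Literature.Probability.LatticeModels.CoarseCellMixingDefectsShapeCount
import HarnessLib

/-!
# Coarse-cell mixing with defects: exponential decay of boundary influence (block-Markov case)

Companion ("theorems only") file of the coarse-cell defect series: the Dobrushin–Shlosman /
van den Berg–Maes mixing theorem through cells WITH Peierls-rare defects, for block-Markov
specifications. If `γ` is block-Markov at the cell scale (`HasBlockLeak cell γ 0 r`), satisfies
the good-exterior finite-size condition `IsGoodFS cell γ good n ε` with `ε · shellCount d n ≤ 3/4`
on a coarse `d`-torus with `≥ 4n+3` cells per axis, and the kernel-uniform Peierls bound at a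
level `q ≤ q₀(d, n)`, then for every cell-union volume, every cell `x`, every source region `F` at
coarse distance `≥ D` from `x`, every `F`-admissible boundary pair and every `[0,1]`-valued
measurable observable `g` of the cell `x`,

`|γ_Λ g(ζ) - γ_Λ g(ζ')| ≤ C θ^D`

with `0 < θ < 1`, `C`, `q₀` depending on `(d, n)` only (`influence_decay_markov_defects`). Proof:
strong induction on `D`, the step being `cubeStep_influence_le` with the single-cell bounds
`δ y = C θ^{D - cdist x y}` supplied by the induction hypothesis; the three terms are absorbed with
`θ^{2n+1} = 6/7` (finite-size contraction `ε s ≤ 3/4`), the entropy bound `sum_clusterShapes_le`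
(near clusters, `q₀` small) and the far-cluster bound (rate `(3^d+1)^2 q ≤ θ`).

## References

* R. L. Dobrushin, S. B. Shlosman, *Constructive criterion for the uniqueness of Gibbs field*
  (1985), §2–3; J. van den Berg, C. Maes, Ann. Probab. 22 (1994), §2; H.-O. Georgii,
  *Gibbs Measures and Phase Transitions* (2011), §8.2.
-/

noncomputable section

open _root_.MeasureTheory
open scoped ENNReal

namespace Literature.Probability.LatticeModels

universe u v

variable {d : ℕ} {μc : Fin d → ℕ}

/-- `cdist x y = 0` forces `x = y`. [folklore] -/
theorem eq_of_cdist_eq_zero {x y : CoarseIdx μc} (h : cdist x y = 0) : x = y := by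
  funext i
  have hi : ((x i - y i).valMinAbs).natAbs ≤ 0 := by
    rw [← h]; exact Finset.le_sup (f := fun i : Fin d => ((x i - y i).valMinAbs).natAbs)
      (Finset.mem_univ i)
  have h0 : (x i - y i).valMinAbs = 0 := by
    have := Nat.le_zero.1 hi
    exact Int.natAbs_eq_zero.1 this
  rw [ZMod.valMinAbs_eq_zero] at h0
  exact sub_eq_zero.1 h0

/-- For `0 < θ ≤ 1` and `m ≤ M`: `θ^{D - m} ≤ θ^D (θ⁻¹)^M` (truncated subtraction). [folklore] -/
theorem pow_tsub_le_mul_inv_pow {θ : ℝ} (hθ : 0 < θ) (hθ1 : θ ≤ 1) {D m M : ℕ} (hmM : m ≤ M) :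
    θ ^ (D - m) ≤ θ ^ D * θ⁻¹ ^ M := by
  have key : θ ^ (D - m) * θ ^ M ≤ θ ^ D := by
    rcases le_or_gt m D with hmD | hmD
    · calc θ ^ (D - m) * θ ^ M ≤ θ ^ (D - m) * θ ^ m :=
            mul_le_mul_of_nonneg_left (pow_le_pow_of_le_one hθ.le hθ1 hmM) (pow_nonneg hθ.le _)
        _ = θ ^ D := by rw [← pow_add, Nat.sub_add_cancel hmD]
    · rw [Nat.sub_eq_zero_of_le hmD.le, pow_zero, one_mul]
      exact pow_le_pow_of_le_one hθ.le hθ1 (by omega)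
  have hM : 0 < θ ^ M := pow_pos hθ M
  calc θ ^ (D - m) = θ ^ (D - m) * θ ^ M * θ⁻¹ ^ M := by
        rw [inv_pow, mul_assoc, mul_inv_cancel₀ hM.ne', mul_one]
    _ ≤ θ ^ D * θ⁻¹ ^ M := mul_le_mul_of_nonneg_right key (pow_nonneg (inv_nonneg.2 hθ.le) _)

/-- **The constants of the decay theorem** (pure arithmetic, depending on `d, n` only):
`θ = (6/7)^{1/(2n+1)}`, `t = θ⁻¹`, `C = 64 (s+1) t^{2n+3}`, and a Peierls threshold `q₀` below which
the far rate `(3^d+1)^2 q ≤ θ`, the entropy smallness `4 B q t ≤ 1` (`B = (2(3^d+1)^2)^s`) and the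
near-cluster prefactor `8 (s + 3^d) B q t^{2n+2} ≤ 1/16` hold (`s = shellCount d n`). [folklore] -/
theorem decay_constants (d n : ℕ) :
    ∃ q₀ θ t C : ℝ, 0 < q₀ ∧ q₀ < 1 ∧ 0 < θ ∧ θ < 1 ∧ 0 < t ∧ 1 ≤ t ∧ t = θ⁻¹ ∧
      (∀ m : ℕ, θ ^ m * t ^ m = 1) ∧ θ ^ (2 * n + 1) = 6 / 7 ∧ 1 ≤ C ∧
      C = 64 * ((shellCount d n : ℝ) + 1) * t ^ (2 * n + 3) ∧
      ∀ q : ℝ, 0 ≤ q → q ≤ q₀ →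
        ((3 : ℝ) ^ d + 1) ^ 2 * q ≤ θ ∧ ((3 : ℝ) ^ d + 1) ^ 2 * q ≤ 1 / 2 ∧
        4 * (2 * ((3 : ℝ) ^ d + 1) ^ 2) ^ shellCount d n * (q * t) ≤ 1 ∧
        8 * ((shellCount d n : ℝ) + 3 ^ d) * (2 * ((3 : ℝ) ^ d + 1) ^ 2) ^ shellCount d n *
          (q * t ^ (2 * n + 2)) ≤ 1 / 16 := by
  /- ### the constants (all depending on `d, n` only) -/
  set s : ℕ := shellCount d n with hs
  set θ : ℝ := Real.exp (-(Real.log (7 / 6) / (2 * n + 1))) with hθ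
  have hθpos : 0 < θ := Real.exp_pos _
  have hlog : 0 < Real.log (7 / 6) := Real.log_pos (by norm_num)
  have hθ1 : θ < 1 := by
    have hneg : -(Real.log (7 / 6) / (2 * n + 1)) < 0 := by
      have : 0 < Real.log (7 / 6) / (2 * n + 1) := by positivity
      linarith
    rw [hθ]
    exact (Real.exp_lt_exp.2 hneg).trans_eq Real.exp_zero
  have hθle : θ ≤ 1 := hθ1.le
  have hθpow : θ ^ (2 * n + 1) = 6 / 7 := by
    rw [hθ, ← Real.exp_nat_mul]
    have : ((2 * n + 1 : ℕ) : ℝ) * -(Real.log (7 / 6) / (2 * n + 1)) = -Real.log (7 / 6) := by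
      push_cast; field_simp
    rw [this, Real.exp_neg, Real.exp_log (by norm_num)]
    norm_num
  set t : ℝ := θ⁻¹ with ht
  have htpos : 0 < t := inv_pos.2 hθpos
  have hθt : θ * t = 1 := mul_inv_cancel₀ hθpos.ne'
  have hθtpow : ∀ m : ℕ, θ ^ m * t ^ m = 1 := fun m => by rw [← mul_pow, hθt, one_pow]
  set X : ℝ := ((3 : ℝ) ^ d + 1) ^ 2 with hX
  have hX1 : 1 ≤ X := one_le_pow₀ (by
    have : (0 : ℝ) ≤ (3 : ℝ) ^ d := by positivity
    linarith)
  set B : ℝ := (2 * X) ^ s with hB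
  have hB1 : 1 ≤ B := one_le_pow₀ (by linarith)
  set W : ℝ := (s : ℝ) + 3 ^ d + 1 with hW
  have hW1 : 1 ≤ W := by
    have : (0 : ℝ) ≤ (s : ℝ) + 3 ^ d := by positivity
    rw [hW]; linarith
  set q₀ : ℝ := θ ^ (2 * n + 2) / (128 * B * X * W) with hq₀
  have hden : 0 < 128 * B * X * W := by positivity
  have hq₀pos : 0 < q₀ := by positivity
  have hθ22pos : 0 < θ ^ (2 * n + 2) := pow_pos hθpos _
  have hq₀mul : q₀ * (128 * B * X * W) = θ ^ (2 * n + 2) := by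
    rw [hq₀]; field_simp
  -- `q₀ t^{2n+2} = 1 / (128 B X W)`
  have hq₀t : q₀ * t ^ (2 * n + 2) * (128 * B * X * W) = 1 := by
    calc q₀ * t ^ (2 * n + 2) * (128 * B * X * W)
        = q₀ * (128 * B * X * W) * t ^ (2 * n + 2) := by ring
      _ = 1 := by rw [hq₀mul, hθtpow]
  have hq₀X : X * q₀ ≤ θ ^ (2 * n + 2) / 128 := by
    rw [le_div_iff₀ (by norm_num : (0 : ℝ) < 128)]
    calc X * q₀ * 128 = q₀ * (128 * X) := by ring
      _ ≤ q₀ * (128 * B * X * W) := by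
          refine mul_le_mul_of_nonneg_left ?_ hq₀pos.le
          have h1 : (0 : ℝ) ≤ 128 * X := by positivity
          calc 128 * X = 128 * X * 1 * 1 := by ring
            _ ≤ 128 * X * B * W := by gcongr
            _ = 128 * B * X * W := by ring
      _ = θ ^ (2 * n + 2) := hq₀mul
  have hθ22le : θ ^ (2 * n + 2) ≤ θ := by
    calc θ ^ (2 * n + 2) ≤ θ ^ 1 := pow_le_pow_of_le_one hθpos.le hθle (by omega)
      _ = θ := pow_one θ
  have hq₀1 : q₀ < 1 := by
    have h1 : q₀ ≤ X * q₀ := le_mul_of_one_le_left hq₀pos.le hX1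
    have h2 : θ ^ (2 * n + 2) / 128 < 1 := by
      rw [div_lt_one (by norm_num)]; linarith
    linarith
  set C : ℝ := 64 * (s + 1) * t ^ (2 * n + 3) with hC
  have ht1 : 1 ≤ t := (one_le_inv₀ hθpos).2 hθle
  have hC1 : 1 ≤ C := by
    have h1 : (1 : ℝ) ≤ t ^ (2 * n + 3) := one_le_pow₀ ht1
    have h2 : (1 : ℝ) ≤ 64 * (s + 1) := by
      have : (0 : ℝ) ≤ s := Nat.cast_nonneg _
      linarith
    rw [hC]; exact one_le_mul_of_one_le_of_one_le h2 h1
  have hC0 : 0 ≤ C := zero_le_one.trans hC1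
  /- arithmetic facts used by the three terms (small context) -/
  -- (A1) far rate and Peierls smallness: `X q ≤ θ`, `X q ≤ 1/2`
  have A1 : ∀ q : ℝ, 0 ≤ q → q ≤ q₀ → X * q ≤ θ ∧ X * q ≤ 1 / 2 := by
    intro q hq hqq₀
    have h1 : X * q ≤ θ ^ (2 * n + 2) / 128 :=
      (mul_le_mul_of_nonneg_left hqq₀ (by positivity)).trans hq₀X
    have h2 : θ ^ (2 * n + 2) / 128 ≤ θ :=
      (div_le_self hθ22pos.le (by norm_num)).trans hθ22le
    have h3 : θ ^ (2 * n + 2) / 128 ≤ 1 / 2 := by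
      have h5 : θ ^ (2 * n + 2) / 128 ≤ 1 / 128 :=
        div_le_div_of_nonneg_right (hθ22le.trans hθle) (by norm_num)
      exact h5.trans (by norm_num)
    exact ⟨h1.trans h2, h1.trans h3⟩
  -- (A2) entropy smallness: `4 B (q t) ≤ 1`
  have A2 : ∀ q : ℝ, 0 ≤ q → q ≤ q₀ → 4 * B * (q * t) ≤ 1 := by
    intro q hq hqq₀
    have h1 : 4 * B * (q * t) ≤ 4 * B * (q₀ * t) :=
      mul_le_mul_of_nonneg_left (mul_le_mul_of_nonneg_right hqq₀ htpos.le) (by positivity)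
    refine h1.trans ?_
    -- `4 B q₀ t = θ^{2n+1} / (32 X W) ≤ 1`
    have h2 : 4 * B * (q₀ * t) * (32 * X * W) = θ ^ (2 * n + 1) := by
      have e : θ ^ (2 * n + 2) = θ ^ (2 * n + 1) * θ := pow_succ θ (2 * n + 1)
      calc 4 * B * (q₀ * t) * (32 * X * W) = q₀ * (128 * B * X * W) * t := by ring
        _ = θ ^ (2 * n + 1) * (θ * t) := by rw [hq₀mul, e]; ring
        _ = θ ^ (2 * n + 1) := by rw [hθt, mul_one]
    have h3 : 0 < 32 * X * W := by positivity
    have h4 : θ ^ (2 * n + 1) ≤ 32 * X * W := by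
      rw [hθpow]
      have hXW : (1 : ℝ) ≤ X * W := one_le_mul_of_one_le_of_one_le hX1 hW1
      calc (6 / 7 : ℝ) ≤ 1 := by norm_num
        _ ≤ 32 * (X * W) := one_le_mul_of_one_le_of_one_le (by norm_num) hXW
        _ = 32 * X * W := by ring
    refine le_of_mul_le_mul_right ?_ h3
    rw [h2, one_mul]
    exact h4
  -- (A3) near-cluster prefactor: `16 (s + 3^d) B q t^{2n+2} ≤ 1/8`... precisely `8 (s+3^d) B q t^{2n+2} ≤ 1/16`
  have A3 : ∀ q : ℝ, 0 ≤ q → q ≤ q₀ → 8 * ((s : ℝ) + 3 ^ d) * B * (q * t ^ (2 * n + 2)) ≤ 1 / 16 := by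
    intro q hq hqq₀
    have h1 : 8 * ((s : ℝ) + 3 ^ d) * B * (q * t ^ (2 * n + 2)) ≤
        8 * ((s : ℝ) + 3 ^ d) * B * (q₀ * t ^ (2 * n + 2)) :=
      mul_le_mul_of_nonneg_left (mul_le_mul_of_nonneg_right hqq₀ (by positivity)) (by positivity)
    refine h1.trans ?_
    -- `8 (s+3^d) B q₀ t^{2n+2} = (s + 3^d) / (16 X W) ≤ 1/16`
    have h2 : 8 * ((s : ℝ) + 3 ^ d) * B * (q₀ * t ^ (2 * n + 2)) * (16 * X * W) = (s : ℝ) + 3 ^ d := by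
      calc 8 * ((s : ℝ) + 3 ^ d) * B * (q₀ * t ^ (2 * n + 2)) * (16 * X * W)
          = ((s : ℝ) + 3 ^ d) * (q₀ * t ^ (2 * n + 2) * (128 * B * X * W)) := by ring
        _ = (s : ℝ) + 3 ^ d := by rw [hq₀t, mul_one]
    have h3 : 0 < 16 * X * W := by positivity
    have h4 : (s : ℝ) + 3 ^ d ≤ 1 / 16 * (16 * X * W) := by
      have hsd : (0 : ℝ) ≤ (s : ℝ) + 3 ^ d := by positivity
      calc (s : ℝ) + 3 ^ d ≤ W := by rw [hW]; linarith
        _ ≤ X * W := le_mul_of_one_le_left (by positivity) hX1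
        _ = 1 / 16 * (16 * X * W) := by ring
    refine le_of_mul_le_mul_right ?_ h3
    rw [h2]
    exact h4
  refine ⟨q₀, θ, t, C, hq₀pos, hq₀1, hθpos, hθ1, htpos, ht1, ht, hθtpow, hθpow, hC1, by rw [hC], ?_⟩
  intro q hq hqq₀
  obtain ⟨h1, h2⟩ := A1 q hq hqq₀
  exact ⟨h1, h2, A2 q hq hqq₀, A3 q hq hqq₀⟩

/-- **Exponential decay of boundary influence for block-Markov specifications with Peierls-rare
defects** (Dobrushin–Shlosman / van den Berg–Maes through cells). See the module docstring.
[folklore] -/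
theorem influence_decay_markov_defects (d n : ℕ) :
    ∃ q₀ θ C : ℝ, 0 < q₀ ∧ q₀ < 1 ∧ 0 < θ ∧ θ < 1 ∧ 1 ≤ C ∧
    ∀ {μc : Fin d → ℕ} {V : Type u} {S : Type v} [MeasurableSpace S] [Fintype V] [DecidableEq V]
      (cell : V → CoarseIdx μc) (γ : Specification V S) (good : CoarseIdx μc → Set (V → S))
      (ε q r : ℝ),
      (∀ i, 4 * n + 3 ≤ μc i + 1) → IsSpecification γ →
      (∀ (c : CoarseIdx μc) (σ τ : V → S), (∀ v, cell v = c → σ v = τ v) →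
        (σ ∈ good c ↔ τ ∈ good c)) → (∀ c, MeasurableSet (good c)) →
      0 ≤ ε → ε * (shellCount d n : ℝ) ≤ 3 / 4 → IsGoodFS cell γ good n ε →
      HasBlockLeak cell γ 0 r → 0 ≤ q → q ≤ q₀ → UniformKernelPeierls cell γ good q →
      ∀ (D : ℕ) (F : Finset (CoarseIdx μc)) (x : CoarseIdx μc), (∀ f ∈ F, D ≤ cdist x f) →
      ∀ (Λ' : Finset V), (∀ v w, cell v = cell w → v ∈ Λ' → w ∈ Λ') →
      ∀ (ζ ζ' : V → S), AdmRegion cell good F Λ' ζ ζ' →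
      ∀ (g : (V → S) → ℝ), Measurable g → (∀ σ, 0 ≤ g σ ∧ g σ ≤ 1) →
        DependsOn g {v | cell v = x} →
        |∫ σ, g σ ∂(γ Λ' ζ) - ∫ σ, g σ ∂(γ Λ' ζ')| ≤ C * θ ^ D := by
  obtain ⟨q₀, θ, t, C, hq₀pos, hq₀1, hθpos, hθ1, htpos, ht1, ht, hθtpow, hθpow, hC1, hC, hfacts⟩ :=
    decay_constants d n
  have hθle : θ ≤ 1 := hθ1.le
  have hC0 : 0 ≤ C := zero_le_one.trans hC1
  set s : ℕ := shellCount d n with hs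
  set B : ℝ := (2 * ((3 : ℝ) ^ d + 1) ^ 2) ^ s with hB
  refine ⟨q₀, θ, C, hq₀pos, hq₀1, hθpos, hθ1, hC1, ?_⟩
  /- ### the main statement -/
  intro μc V S _ _ _ cell γ good ε q r hμ hγ hgl hgm hε hεs hFS hBL hq hqq₀ hUKP
  obtain ⟨hXqθ, hq2, hA2, hA3⟩ := hfacts q hq hqq₀
  have hq1 : q < 1 := hqq₀.trans_lt hq₀1
  have hqle1 : q ≤ 1 := hq1.le
  intro D
  induction D using Nat.strong_induction_on with
  | _ D IH =>
  intro F x hxF Λ' hΛ' ζ ζ' hadm g hgm' hg01 hgdep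
  haveI := hγ.isProbability Λ' ζ
  haveI := hγ.isProbability Λ' ζ'
  -- the trivial bound
  have htriv : |∫ σ, g σ ∂(γ Λ' ζ) - ∫ σ, g σ ∂(γ Λ' ζ')| ≤ 1 := by
    obtain ⟨h1, h2⟩ := integral_mem_unitInterval (μ := γ Λ' ζ) hgm' hg01
    obtain ⟨h3, h4⟩ := integral_mem_unitInterval (μ := γ Λ' ζ') hgm' hg01
    rw [abs_le]; constructor <;> linarith
  by_cases hDsmall : D ≤ 2 * n + 2
  · -- base: `C θ^D ≥ C θ^{2n+2} = 64 (s+1) t ≥ 1`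
    refine htriv.trans ?_
    have h1 : θ ^ (2 * n + 2) ≤ θ ^ D := pow_le_pow_of_le_one hθpos.le hθle hDsmall
    have h2 : (1 : ℝ) ≤ C * θ ^ (2 * n + 2) := by
      have e : C * θ ^ (2 * n + 2) = 64 * (s + 1) * t * (θ ^ (2 * n + 2) * t ^ (2 * n + 2)) := by
        rw [hC]; ring
      rw [e, hθtpow, mul_one]
      have hs0 : (0 : ℝ) ≤ s := Nat.cast_nonneg _
      exact one_le_mul_of_one_le_of_one_le (by linarith) ht1
    exact h2.trans (mul_le_mul_of_nonneg_left h1 hC0)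
  · have hD : 2 * n + 3 ≤ D := by omega
    -- the single-cell bounds from the induction hypothesis
    set δ : CoarseIdx μc → ℝ := fun y => if y = x then 1 else C * θ ^ (D - cdist x y) with hδdef
    have hδ0 : ∀ y, 0 ≤ δ y := fun y => by
      simp only [hδdef]; split_ifs
      · exact zero_le_one
      · positivity
    have hR : ∀ (Λ : Finset V), (∀ v w, cell v = cell w → v ∈ Λ → w ∈ Λ) →
        ∀ (y : CoarseIdx μc) (g : (V → S) → ℝ), Measurable g → (∀ σ, 0 ≤ g σ ∧ g σ ≤ 1) →
        DependsOn g {v | cell v = y} →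
        ∀ ζ ζ' : V → S, AdmRegion cell good F Λ ζ ζ' →
          |∫ σ, g σ ∂(γ Λ ζ) - ∫ σ, g σ ∂(γ Λ ζ')| ≤ δ y := by
      intro Λ hΛ y g' hg'm hg'01 hg'dep ζ₁ ζ₁' hadm₁
      haveI := hγ.isProbability Λ ζ₁
      haveI := hγ.isProbability Λ ζ₁'
      by_cases hyx : y = x
      · simp only [hδdef, hyx, if_true]
        obtain ⟨h1, h2⟩ := integral_mem_unitInterval (μ := γ Λ ζ₁) hg'm hg'01
        obtain ⟨h3, h4⟩ := integral_mem_unitInterval (μ := γ Λ ζ₁') hg'm hg'01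
        rw [abs_le]; constructor <;> linarith
      · simp only [hδdef, hyx, if_false]
        have hpos : 1 ≤ cdist x y := by
          by_contra h0
          push Not at h0
          exact hyx (eq_of_cdist_eq_zero (by omega)).symm
        have hlt : D - cdist x y < D := by omega
        refine IH (D - cdist x y) hlt F y (fun f hf => ?_) Λ hΛ ζ₁ ζ₁' hadm₁ g' hg'm hg'01 hg'dep
        have h1 := hxF f hf
        have h2 : cdist x f ≤ cdist x y + cdist y f := cdist_triangle _ _ _
        omega
    have hstep := cubeStep_influence_le hγ hgl hgm hε hFS hBL hq hq2 hq1 hUKP F x hD hxF hδ0 hR Λ'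
      hΛ' ζ ζ' hadm g hgm' hg01 hgdep
    refine hstep.trans ?_
    -- notation as in the cube step
    set Q : Finset (CoarseIdx μc) := Finset.univ.filter fun c : CoarseIdx μc => cdist x c ≤ 2 * n
      with hQdef
    set Y : Finset (CoarseIdx μc) := (Finset.univ.filter fun c : CoarseIdx μc =>
      cdist x c = 2 * n + 1).filter (fun c => ∀ v, cell v = c → v ∈ Λ') with hYdef
    set U : Finset (CoarseIdx μc) := Finset.univ.filter fun c : CoarseIdx μc => cdist x c ≤ D - 2
      with hUdef
    set 𝒩 := (clusterShapes 1 Finset.univ Y).filter (fun K => K.Nonempty ∧ K ⊆ U) with h𝒩def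
    set Rg : Finset (CoarseIdx μc) → Finset (CoarseIdx μc) := fun K =>
      ((Y ∪ fatten Finset.univ (Q ∪ K) 1) \ (Q ∪ K)).filter (fun c => ∀ v, cell v = c → v ∈ Λ')
      with hRgdef
    have hmemQ : ∀ c, c ∈ Q ↔ cdist x c ≤ 2 * n := fun c => by simp [hQdef]
    have hmemY : ∀ c, c ∈ Y ↔ cdist x c = 2 * n + 1 ∧ ∀ v, cell v = c → v ∈ Λ' := fun c => by
      simp [hYdef]
    have hYcard_nat : Y.card ≤ s :=
      (Finset.card_le_card (Finset.filter_subset _ _)).trans (card_shell_le_shellCount x n hμ)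
    have hYcard : (Y.card : ℝ) ≤ s := by exact_mod_cast hYcard_nat
    -- `θ^D = θ^{D - (2n+1)} θ^{2n+1}` and `θ^{D - 2n - 3} = θ^D t^{2n+3}`
    have hθD : θ ^ D = θ ^ (D - (2 * n + 1)) * θ ^ (2 * n + 1) := by
      rw [← pow_add, Nat.sub_add_cancel (by omega)]
    have hθD3 : θ ^ (D - 2 * n - 3) = θ ^ D * t ^ (2 * n + 3) := by
      have e : θ ^ D = θ ^ (D - 2 * n - 3) * θ ^ (2 * n + 3) := by
        rw [← pow_add]; congr 1; omega
      rw [e, mul_assoc, hθtpow, mul_one]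
    /- (T1) the contraction term -/
    have hT1 : ε * ∑ y ∈ Y, δ y ≤ 7 / 8 * (C * θ ^ D) := by
      have hδY : ∀ y ∈ Y, δ y = C * θ ^ (D - (2 * n + 1)) := by
        intro y hy
        have hxy := ((hmemY y).1 hy).1
        have hyx : y ≠ x := fun h => by rw [h, cdist_self] at hxy; omega
        simp only [hδdef, hyx, if_false, hxy]
      rw [Finset.sum_congr rfl hδY, Finset.sum_const, nsmul_eq_mul]
      have hM : 0 ≤ C * θ ^ (D - (2 * n + 1)) := by positivity
      have hεY : ε * Y.card ≤ 3 / 4 := (mul_le_mul_of_nonneg_left hYcard hε).trans hεs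
      have h3 : C * θ ^ (D - (2 * n + 1)) = 7 / 6 * (C * θ ^ D) := by
        have : θ ^ D = θ ^ (D - (2 * n + 1)) * (6 / 7) := by rw [hθD, hθpow]
        rw [this]; ring
      calc ε * (Y.card * (C * θ ^ (D - (2 * n + 1))))
          = (ε * Y.card) * (C * θ ^ (D - (2 * n + 1))) := by ring
        _ ≤ 3 / 4 * (C * θ ^ (D - (2 * n + 1))) := mul_le_mul_of_nonneg_right hεY hM
        _ = 7 / 8 * (C * θ ^ D) := by rw [h3]; ring
    /- (T2) the near cluster terms -/
    have hT2 : ∑ K ∈ 𝒩, 2 * q ^ K.card * ∑ y ∈ Rg K, δ y ≤ 1 / 16 * (C * θ ^ D) := by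
      -- each ring cell differs from `x` and lies within `2n+1+|K|` of `x`
      have hδR : ∀ K ∈ 𝒩, ∀ y ∈ Rg K, δ y ≤ C * θ ^ D * (t ^ (2 * n + 1) * t ^ K.card) := by
        intro K hK y hy
        obtain ⟨hKsh, -, hKU⟩ := Finset.mem_filter.1 hK
        have hKshape := (mem_clusterShapes.1 hKsh).2
        obtain ⟨hy1, -⟩ := Finset.mem_filter.1 hy
        obtain ⟨hy2, hyQK⟩ := Finset.mem_sdiff.1 hy1
        have hyQ : y ∉ Q := fun h => hyQK (Finset.mem_union_left _ h)
        have hyx : y ≠ x := fun h => hyQ ((hmemQ y).2 (by rw [h, cdist_self]; exact Nat.zero_le _))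
        have hdist : cdist x y ≤ 2 * n + 1 + K.card := by
          rcases Finset.mem_union.1 hy2 with hyY | hyf
          · have := ((hmemY y).1 hyY).1; omega
          · obtain ⟨-, k, hk, hky⟩ := mem_fatten.1 hyf
            rcases Finset.mem_union.1 hk with hkQ | hkK
            · have := (hmemQ k).1 hkQ
              have := cdist_triangle x k y
              omega
            · obtain ⟨s', hs'Y, -, hs'k⟩ := hKshape.exists_seed_cdist_le hkK
              have h1 := ((hmemY s').1 hs'Y).1
              have h2 := cdist_triangle x s' k
              have h3 := cdist_triangle x k y
              have h4 : 1 ≤ K.card := Finset.card_pos.2 ⟨k, hkK⟩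
              rw [one_mul] at hs'k
              omega
        simp only [hδdef, hyx, if_false]
        have hp := pow_tsub_le_mul_inv_pow (D := D) hθpos hθle hdist
        rw [← ht] at hp
        calc C * θ ^ (D - cdist x y) ≤ C * (θ ^ D * t ^ (2 * n + 1 + K.card)) :=
              mul_le_mul_of_nonneg_left hp hC0
          _ = C * θ ^ D * (t ^ (2 * n + 1) * t ^ K.card) := by rw [pow_add]; ring
      -- the ring has at most `s + 3^d |K|` cells
      have hRcard : ∀ K ∈ 𝒩, ((Rg K).card : ℝ) ≤ s + 3 ^ d * K.card := by
        intro K _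
        have hsub : Rg K ⊆ Y ∪ fatten Finset.univ K 1 := by
          intro y hy
          obtain ⟨hy1, hyΛ⟩ := Finset.mem_filter.1 hy
          obtain ⟨hy2, hyQK⟩ := Finset.mem_sdiff.1 hy1
          rcases Finset.mem_union.1 hy2 with hyY | hyf
          · exact Finset.mem_union_left _ hyY
          · obtain ⟨-, k, hk, hky⟩ := mem_fatten.1 hyf
            rcases Finset.mem_union.1 hk with hkQ | hkK
            · refine Finset.mem_union_left _ ((hmemY y).2 ⟨?_, hyΛ⟩)
              have h1 := (hmemQ k).1 hkQ
              have h2 := cdist_triangle x k y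
              have h3 : ¬ cdist x y ≤ 2 * n :=
                fun h => hyQK (Finset.mem_union_left _ ((hmemQ y).2 h))
              omega
            · exact Finset.mem_union_right _ (mem_fatten.2 ⟨Finset.mem_univ _, k, hkK, hky⟩)
        have h1 := (Finset.card_le_card hsub).trans (Finset.card_union_le _ _)
        have h2 := card_fatten_le (Finset.univ : Finset (CoarseIdx μc)) K 1
        have h4 : (Rg K).card ≤ s + 3 ^ d * K.card := by
          have : (2 * 1 + 1) ^ d * K.card = 3 ^ d * K.card := by norm_num
          omega
        exact_mod_cast h4
      -- termwise bound
      have hterm : ∀ K ∈ 𝒩, 2 * q ^ K.card * ∑ y ∈ Rg K, δ y ≤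
          2 * C * θ ^ D * t ^ (2 * n + 1) * ((q * t) ^ K.card * (s + 3 ^ d * K.card)) := by
        intro K hK
        have h1 : ∑ y ∈ Rg K, δ y ≤ (Rg K).card * (C * θ ^ D * (t ^ (2 * n + 1) * t ^ K.card)) := by
          have := Finset.sum_le_sum (hδR K hK)
          rwa [Finset.sum_const, nsmul_eq_mul] at this
        have h2 : ∑ y ∈ Rg K, δ y ≤
            (s + 3 ^ d * K.card) * (C * θ ^ D * (t ^ (2 * n + 1) * t ^ K.card)) :=
          h1.trans (mul_le_mul_of_nonneg_right (hRcard K hK) (by positivity))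
        calc 2 * q ^ K.card * ∑ y ∈ Rg K, δ y
            ≤ 2 * q ^ K.card * ((s + 3 ^ d * K.card) * (C * θ ^ D * (t ^ (2 * n + 1) * t ^ K.card))) :=
              mul_le_mul_of_nonneg_left h2 (by positivity)
          _ = 2 * C * θ ^ D * t ^ (2 * n + 1) * ((q * t) ^ K.card * (s + 3 ^ d * K.card)) := by
              rw [mul_pow]; ring
      refine (Finset.sum_le_sum hterm).trans ?_
      rw [← Finset.mul_sum]
      -- enlarge to all nonempty shapes and use the entropy bound
      have hz : 0 ≤ q * t := mul_nonneg hq htpos.le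
      have hX1 : (1 : ℝ) ≤ ((3 : ℝ) ^ d + 1) ^ 2 := one_le_pow₀ (by
        have : (0 : ℝ) ≤ (3 : ℝ) ^ d := by positivity
        linarith)
      have hBY : (2 * ((3 : ℝ) ^ d + 1) ^ 2) ^ Y.card ≤ B :=
        pow_le_pow_right₀ (by linarith) hYcard_nat
      have hBz : 4 * (2 * ((3 : ℝ) ^ d + 1) ^ 2) ^ Y.card * (q * t) ≤ 1 :=
        (mul_le_mul_of_nonneg_right (mul_le_mul_of_nonneg_left hBY (by norm_num)) hz).trans
          hA2
      have hsum := sum_clusterShapes_le Y hz (Nat.cast_nonneg s) (by positivity : (0 : ℝ) ≤ 3 ^ d) hBz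
      have hsub : 𝒩 ⊆ (clusterShapes 1 Finset.univ Y).filter (fun K => K.Nonempty) := by
        intro K hK
        obtain ⟨h1, h2, -⟩ := Finset.mem_filter.1 hK
        exact Finset.mem_filter.2 ⟨h1, h2⟩
      have hle := Finset.sum_le_sum_of_subset_of_nonneg hsub (f := fun K =>
        (q * t) ^ K.card * ((s : ℝ) + 3 ^ d * K.card)) (fun K _ _ => by positivity)
      have hfac : 0 ≤ 2 * C * θ ^ D * t ^ (2 * n + 1) := by positivity
      have hsd : 0 ≤ 4 * ((s : ℝ) + 3 ^ d) := by positivity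
      calc 2 * C * θ ^ D * t ^ (2 * n + 1) * ∑ K ∈ 𝒩, (q * t) ^ K.card * (s + 3 ^ d * K.card)
          ≤ 2 * C * θ ^ D * t ^ (2 * n + 1) *
              (4 * (s + 3 ^ d) * (2 * ((3 : ℝ) ^ d + 1) ^ 2) ^ Y.card * (q * t)) :=
            mul_le_mul_of_nonneg_left (hle.trans hsum) hfac
        _ ≤ 2 * C * θ ^ D * t ^ (2 * n + 1) * (4 * (s + 3 ^ d) * B * (q * t)) :=
            mul_le_mul_of_nonneg_left
              (mul_le_mul_of_nonneg_right (mul_le_mul_of_nonneg_left hBY hsd) hz) hfac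
        _ = C * θ ^ D * (8 * (s + 3 ^ d) * B * (q * t ^ (2 * n + 2))) := by ring
        _ ≤ C * θ ^ D * (1 / 16) := mul_le_mul_of_nonneg_left hA3 (by positivity)
        _ = 1 / 16 * (C * θ ^ D) := by ring
    /- (T3) the far term -/
    have hT3 : 2 * (Y.card * (2 * q * (((3 : ℝ) ^ d + 1) ^ 2 * q) ^ (D - 2 * n - 3))) ≤
        1 / 16 * (C * θ ^ D) := by
      have hx0 : 0 ≤ ((3 : ℝ) ^ d + 1) ^ 2 * q := by positivity
      have h1 : (((3 : ℝ) ^ d + 1) ^ 2 * q) ^ (D - 2 * n - 3) ≤ θ ^ (D - 2 * n - 3) :=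
        pow_le_pow_left₀ hx0 hXqθ _
      have h4 : (Y.card : ℝ) * (2 * q * (((3 : ℝ) ^ d + 1) ^ 2 * q) ^ (D - 2 * n - 3)) ≤
          s * (2 * q * θ ^ (D - 2 * n - 3)) :=
        mul_le_mul hYcard (mul_le_mul_of_nonneg_left h1 (by positivity)) (by positivity)
          (Nat.cast_nonneg _)
      have h6 : (s : ℝ) * q ≤ s + 1 := by
        have := mul_le_mul_of_nonneg_left hqle1 (Nat.cast_nonneg s)
        rw [mul_one] at this
        linarith
      have h8 : 0 ≤ θ ^ (D - 2 * n - 3) := pow_nonneg hθpos.le _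
      calc 2 * (Y.card * (2 * q * (((3 : ℝ) ^ d + 1) ^ 2 * q) ^ (D - 2 * n - 3)))
          ≤ 2 * (s * (2 * q * θ ^ (D - 2 * n - 3))) := mul_le_mul_of_nonneg_left h4 (by norm_num)
        _ = 4 * (s * q) * θ ^ (D - 2 * n - 3) := by ring
        _ ≤ 4 * (s + 1) * θ ^ (D - 2 * n - 3) := mul_le_mul_of_nonneg_right (by linarith) h8
        _ = 1 / 16 * (C * θ ^ D) := by rw [hθD3, hC]; ring
    -- assemble
    have : ε * ∑ y ∈ Y, δ y + ∑ K ∈ 𝒩, 2 * q ^ K.card * ∑ y ∈ Rg K, δ y +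
        2 * (Y.card * (2 * q * (((3 : ℝ) ^ d + 1) ^ 2 * q) ^ (D - 2 * n - 3))) ≤ C * θ ^ D := by
      linarith
    exact this

end Literature.Probability.LatticeModels
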